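import Literature.MathematicalPhysics.QuantumFieldTheory.Balaban1983to89.Node00.N24Thm1Stage13RebindXWithB8PinB10Y0ZW0SepCoPHG
import Summits.QuantumFields.YangMills.Theorems.BalabanUVNodesK1RunwiseLettersOfBoxHAtRecord
import Summits.QuantumFields.YangMills.Theorems.BalabanUVNodesK1WindowExactCriterion
import Summits.QuantumFields.YangMills.Theorems.BalabanUVNodesK1NodeOLadderRunwiseEdges
import Summits.QuantumFields.YangMills.Theorems.BalabanUVNodesN13Cor3AEKeepZeroOfEnginesRowAtRecord13
import Summits.QuantumFields.YangMills.Theorems.BalabanUVNodesN12AtRecord12Pointed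
import Summits.QuantumFields.YangMills.Theorems.BalabanUVNodesK1V6Defs

/-!
# NODE N24 (B2) — PART 37 AT AN ABSTRACT WITNESS WITH THE [B9] BUNDLE FREE (`Y₀`-GENERIC PIN): the pointed Theorem-1 door, K1⁹'s consequent per `F`, and K1⁹ `StabilityBRunRowsAtRecordR13SepCoPHV`
# (stmt-QuantumFields-27364) BY ITS ROUTE NAME — p650613 §1–§3 with `h06 : B9LeafX Y₀` for ANY `Y₀ : PrintedCarriers9X`, so that the K1 face can display N06 at its object of record `Y9OfRecordP`

TRACK A (YM-PLAN §2d, node N24 of 28 = binder B2), seat `pub-ymgap-dag-n24-c` (R134 s2; gen 14, INTENT-68).  Key of record K1⁹ = stmt-QuantumFields-27364 (`--kind proof --supports 27364 --as helper`,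
Summits lane; count-neutral).  [V] = [Balaban1989LargeFieldII]; [III] = [Balaban1988Convergent]; [I] = [Balaban1987RG1]; [B9] = [Balaban1985BackgroundPropagators].

WHY (dag-lead DEDUP-288 (1b), 2026-08-27 «n24 pens port their knits»; node00-def-K0a FILE 19 `Node00/CarriersYP`: `Y9OfRecordP` = the [B9] bundle over print's re-sized class, N06's OBJECT OF RECORD;
dag-n06-d's certificate of record concludes `B9LeafX (Y9OfRecordP …)`; `B9LeafXClassAntitone`: the literal-class leaf `B9LeafX (Y9OfRecord …)` implies the P-class leaf, NOT conversely).  p650613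
(this seat's door-free ∕ witness-free slot-road engine) spells N06's family as `∃ Mstar ops, B9LeafX (Y9OfRecord … Mstar ops)` and builds its world with `pinY (Y9OfRecord …)`; every lemma
underneath is value-generic in the bundle (INTENT-67 `Node00/N24Thm1Stage13RebindXWithB8PinB10Y0ZW0SepCoPHG`: the record ∕ hosting ∕ eleven-nodes lemmas for a FREE `Y₀`).  THIS FILE is
p650613 §1–§3 with the bundle free: §1∕§2 take `(Y₀ : PrintedCarriers9X) (h06 : B9LeafX Y₀)`, §3 takes a bundle FAMILY `Y₀ F i` with `h06 : ∀ F i, B9LeafX (Y₀ F i)`; proofs = p650613's bytes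
with the world pinned at `Y₀` and the two engine lemmas replaced by their `Y₀` twins.  The K1 faces of record at the printed normalisation re-keyed on this file (INTENT-69∕70) display
`h06 : ∀ F, ∃ Mstar ops, B9LeafX (Y9OfRecordP 2 (stage3OfFamily F) Mstar ops)`.

EDITION 2 (CLASS S, IN PLACE — seat g21, 2026-08-30; director-ym №365 (3) ∕ №395 road (i); this seat's `N24-G20-ENGINE-V2-DESIGN.md` §3 (b)).  The three public STATEMENTS are
BYTE-IDENTICAL to edition 1 (p65xxxx lineage, INTENT-68); only the IMPORTS and four proof tokens changed.  Edition 1 imported `…Slot8Thm1AEAtAbstractWitness` (⇒ `…AtThm1CCMWZ` ⇒ the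
`…WorldBuilt` chain), which is post-Stage-2 RESIDUE (own-text red after rows 10d∕10e of the R549 campaign — node00-def-RR-2 FINDING-2, dag-n11-d's probes I.19732); of that chain the proofs
read exactly three small run-wise lemmas (`runwiseCeiling_of_betaUpperH`, `frequently_betaZero_le_of_runwiseCeiling`, `flowStepPrinted_leavesP_of_ceiling_noShrinkG`), now taken from
dag-n07-w3's residue-free homes `K1RunwiseLettersOfBoxH.runCeiling_of_betaUpperH ∕ exists_frequently_betaZero_le_of_runCeiling` (✓p775657) and
`K1RunwiseLettersOfBoxHAtRecord.flowStepPrinted_leavesP_of_betaUpperH_noShrinkG` (✓p776781, box currency: the ceiling is read off `hbox'` inside); the vocabulary modules the statements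
need (`K1WindowExactCriterion`, `K1NodeOLadderRunwiseEdges`, `N13Cor3AEKeepZero…`, `N12AtRecord12Pointed`, `K1V6Defs`) are imported directly; the stale `open … (…)` lines of the residue
chain are dropped.  Consumer: the collapsed K1 engine v2 (`…PosN09T5BAtGaussPinPrintedZBY`).  Nothing else changed; nothing of Bałaban newly asserted.

WHAT THIS FILE PROVES (3 theorems, 0 `def`, 0 `sorry`; standard axioms; general `N` in §1, `N = 2` in §2–§3): §1 `N24_thm1R13SepCoPH_worldBuiltG_childrenSplitSlot8_psFloor_atWitness_pinY₀_pointed` · §2 `N24_stabilityBRunRowsR13SepCoPHV_consequent_childrenSplitSlot8Thm1AE_atWitness_pinY₀_of_runRowsCont` · §3 ★★★★ `N24_stabilityBRunRowsAtRecordR13SepCoPHV_byName_of_abstractWitnessFamily_childrenSplitSlot8Thm1AE_pinY₀_of_runRowsCont` ⊢ the route decl.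

HONEST FRAMING.  Composition BY NAME (p650613's proofs with one pin freed); NO estimate; nothing of Bałaban's asserted; every family DISPLAYED (CONDITIONAL, audit `proof.conditional`); a FREE
bundle `Y₀` is junk-inhabitable at this ENGINE level exactly as def-Y's `Y9OfRecord … ops` is over a junk operator layer — the honest display of N06 is the FACE's (`Y9OfRecordP` + N06's operator
layer of record); no v10 stub used or closed; N05 ∕ N06 ∕ N11 ∕ N13 NOT discharged; N24 COMPOSITE — no count moved (typed 28∕28 · discharged 6∕27 · A 6∕28); K0⁷ ∕ K1⁹ stmt-QuantumFields-27364
(DECIDING; v10 0∕6, HARD FREEZE respected) ∕ K3⁸ OPEN; one finite 𝕋⁴ programme at fixed ε, Bałaban AS PRINTED; R4 = the conditional finite-𝕋⁴ rung `BalabanLadder.UV` only — NOT continuum ∕ ℝ⁴ ∕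
OS ∕ mass gap ∕ Clay: the Yang–Mills mass gap is NOT proved by any of this.  No `sorry`, `def`, `instance`, `notation`; standard axioms.
-/

noncomputable section

open scoped Matrix.Norms.L2Operator BigOperators
open Filter Topology MeasureTheory

namespace Summit.QuantumFields.YangMills.BalabanUVNodes.N24K1R9ByNameOfOpenStubsChildrenSplitSlot8Thm1AEAtAbstractWitnessY0

open Literature.MathematicalPhysics.QuantumFieldTheory.Balaban1983to89
open Literature.MathematicalPhysics.QuantumFieldTheory.Balaban1983to89.Node00
open DagBinding T4Continuum T4DatumAssembly FlowStepRuns AveragingRT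
open FlowStep (HBeta RGEqH prefixOf prefixOf_apply BetaLowerH BetaUpperH Box mem_box clampPrefix Y)
open Summit.QuantumFields.YangMills.BalabanUVNodes.N12AtRecord12Pointed (exists_printedCarriers15_b15Leaf)
open Summit.QuantumFields.YangMills.Theorems.K1RunwiseLettersOfBoxH (runCeiling_of_betaUpperH exists_frequently_betaZero_le_of_runCeiling)
open Summit.QuantumFields.YangMills.Theorems.K1RunwiseLettersOfBoxHAtRecord (flowStepPrinted_leavesP_of_betaUpperH_noShrinkG)
open Summit.QuantumFields.YangMills.Theorems.BalabanUVNodesK1WindowExactCriterion (window_of_frequently_beta_le)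
open Summit.QuantumFields.YangMills.Theorems.K1NodeOLadderRunwiseEdges (exists_noShrink_of_psFloor)
open Summit.QuantumFields.YangMills.BalabanUVNodes.N13Cor3AEKeepZeroOfEnginesRowAtRecord13 (exists_revision₁₃_endStatementBPrinted_of_thm1_of_row0_of_aeRowSucc)


open Summit.QuantumFields.YangMills.Theorems.K1V6Defs (Inhabited13)

variable {F : T4Family} {N : ℕ} [NeZero N]

/-! ## §1. General `N`: THE POINTED THEOREM-1 DOOR AT AN ABSTRACT WITNESS WITH A FREE [B9] BUNDLE `Y₀` (N05 at `Slot8`, N06 ← `B9LeafX Y₀`, N07–N11, NODE O's PS floor; N12- and N13-free) -/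

/-- **THE POINTED THEOREM-1 DOOR AT AN ABSTRACT WITNESS, [B9] BUNDLE FREE** — p650613 §1 with `h06 : B9LeafX Y₀` for any `Y₀ : PrintedCarriers9X`: guard ∧ admissible ∧
`B16.Thm1Printed (datumOfRecord₁₃SepCoPH F N θ hP).C` ∧ window, from the four door rows, `0 < θ.γ` + upper box, N05 (`Slot8`), N06 (`Y₀`), N07–N10 (+ `h09T`), N11's `h11`, NODE O's PS floor;
world pinned at `pinY Y₀`, hosting ∕ eleven nodes by INTENT-67's `…pinB10Y₀ZW₀` twins.  CONDITIONAL; nothing of Bałaban asserted.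
[cite: Balaban1989LargeFieldII, Thm 1 p.355, (0.1) pp.355–356, p.387, p.391; Balaban1988Convergent, (0.2) p.244, Thm 2 p.263; Balaban1987RG1, Thm 3 p.264, (1.20)–(1.22) p.264, §1 pp.263–264, (0.17)–(0.20) pp.255–256; Balaban1985RegularSpaces, Prop. 7 (1.145) p.100, Thm 8 (1.146) p.101; Balaban1985BackgroundPropagators, Thm 3.1 p.397; Balaban1988RG2Cluster, Lemmas 1–3 pp.9–20 (bookkeeping)] -/
theorem N24_thm1R13SepCoPH_worldBuiltG_childrenSplitSlot8_psFloor_atWitness_pinY₀_pointed (Slot8 : (θ₃ : Stage3Params) → ResidB8 θ₃ → Prop) (θ : Stage13HParams F N)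
    (hP : θ.Provisos₁₃SepCoPH F N) (hθ : θ.Admissible F N) (hU : θ.ZhUnity F N ∧ θ.SlotsNondegenerate₁₃ F N)
    (hlaws : ∀ (P : B12.RunParams) (k : ℕ), k < P.K → TLaw₁₃CoPH F N θ P k → SLaw₁₃CoPH F N θ P (k + 1))
    {β' : ℝ} (hγ₀ : 0 < θ.γ) (hbox' : BetaUpperH β' θ.γ (betaOfRecord₁₃ F N θ.toStage13Params))
    (h05 : ∃ lam8 : ResidB8 θ.toStage13Params.toStage3Params, Slot8 θ.toStage13Params.toStage3Params lam8)
    (Y₀ : PrintedCarriers9X) (h06 : B9LeafX Y₀)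
    (h07 : ∃ ζ : ResidZ F N, B11Leaf (Z11OfRecord F N ζ))
    (h08 : PrintedUV3V N θ.L)
    (h09 : ∃ lam12 : ResidB12 F N θ.toStage13Params.τ9.M,
      ∀ P : B12.RunParams, B12Sec2to5.Lemma4Printed (F12OfRecord₁₂ F N θ.toStage13Params.toStage12Params lam12 P) (lam12 P).consts)
    (h09T : ∃ γ₉ : ℝ, 0 < γ₉ ∧ ∀ w : WorldP, w.C = (datumOfRecord₁₃SepCoPH F N θ hP).C →
      w.γ ≤ γ₉ → ∀ P : B12.RunParams, (leavesP w P).smallCouplings → (leavesP w P).smallFieldInductive)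
    (h10 : ∃ lam13 : B12.RunParams → ResidB13 θ.toStage13Params.toStage3Params,
      ∀ P : B12.RunParams, B13LeafOfRecord θ.toStage13Params.toStage3Params (lam13 P))
    (h11 : ∀ βup β₀ : ℝ, ∃ γ₁₁ : ℝ, 0 < γ₁₁ ∧ ∀ w : WorldP, w.C = (datumOfRecord₁₃SepCoPH F N θ hP).C →
      w.βup = βup → w.β₀ = β₀ → w.γ ≤ γ₁₁ → ∀ P : B12.RunParams, (leavesP w P).b7 → (leavesP w P).b8 → (leavesP w P).b9 → (leavesP w P).b10 → (leavesP w P).b11 →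
      (leavesP w P).smallCouplings → (leavesP w P).smallFieldInductive → (leavesP w P).flowControl →
        ∀ k, k < P.K → SLaw₁₃CoPH F N θ P k → TLaw₁₃CoPH F N θ P k)
    {γR M : ℝ} (hγR : 0 < γR)
    (hps : ∀ (n : ℕ) (gs : ℕ → ℝ), RGEqH n (betaOfRecord₁₃ F N θ.toStage13Params) gs → Step.InInterval γR n gs → ∀ k, k ≤ n → -M ≤ ∑ j ∈ Finset.Ico k n, betaOfRecord₁₃ F N θ.toStage13Params j (prefixOf gs j)) :
    (θ.ZhUnity F N ∧ θ.SlotsNondegenerate₁₃ F N) ∧ θ.Admissible F N ∧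
      B16.Thm1Printed (datumOfRecord₁₃SepCoPH F N θ hP).C ∧
      ∃ γ₁ : ℝ, 0 < γ₁ ∧ ∀ γ' : ℝ, 0 < γ' → γ' ≤ γ₁ → ∃ P : B12.RunParams, 1 ≤ P.K ∧ ((datumOfRecord₁₃SepCoPH F N θ hP).C P).flow.InInterval γ' P.K := by
  obtain ⟨lam8, h05⟩ := h05
  obtain ⟨ζ, h07⟩ := h07
  obtain ⟨lam12, h09⟩ := h09
  obtain ⟨lam13, h10⟩ := h10
  obtain ⟨γ₉, hγ₉, h09T⟩ := h09T
  obtain ⟨γ₁₁, hγ₁₁, h11⟩ := h11 β' 1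
  obtain ⟨γ', hγ', -, hns⟩ := exists_noShrink_of_psFloor one_pos hγR hps
  have hL1 : (1 : ℝ) < (θ.toStage13Params.L : ℝ) := by exact_mod_cast θ.toStage13Params.hL.2
  have hγw0 : 0 < min θ.γ (min γ₉ (min γ₁₁ γ')) := lt_min hγ₀ (lt_min hγ₉ (lt_min hγ₁₁ hγ'))
  have hγwγ : min θ.γ (min γ₉ (min γ₁₁ γ')) ≤ θ.γ := min_le_left _ _
  have hγw9 : min θ.γ (min γ₉ (min γ₁₁ γ')) ≤ γ₉ := (min_le_right _ _).trans (min_le_left _ _)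
  have hγw11 : min θ.γ (min γ₉ (min γ₁₁ γ')) ≤ γ₁₁ := (min_le_right _ _).trans ((min_le_right _ _).trans (min_le_left _ _))
  have hγw13 : min θ.γ (min γ₉ (min γ₁₁ γ')) ≤ γ' := (min_le_right _ _).trans ((min_le_right _ _).trans (min_le_right _ _))
  set γw : ℝ := min θ.γ (min γ₉ (min γ₁₁ γ'))
  let w : WorldP :=
    { C := (datumOfRecord₁₃SepCoPH F N θ hP).C
      γ := γw, em := fun _ => 0, ep := fun _ => 0, βup := β', β₀ := 1, β₀_pos := one_pos, b := 1, b_pos := one_pos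
      L := (θ.toStage13Params.L : ℝ), one_lt_L := hL1, gR := 0
      up := fun P => (upOfRecord₅C F N ((((((θ.rebindX F N (fun P : B12.RunParams => (((θ.toStage13Params.res.X P).withB12 (F12OfRecord₁₂ F N θ.toStage13Params.toStage12Params lam12 P) (lam12 P).consts).withB13OfRecord θ.toStage13Params.toStage3Params (lam13 P)))).toStage5₁₃CoPH F N).pinB10 F N).pinY F N (Y₀)).pinZ F N (Z11OfRecord F N ζ)).pinW F N (fun P : B12.RunParams => (exists_printedCarriers15_b15Leaf (F.P P.K)).choose)) P).withB8 (Slot8 θ.toStage13Params.toStage3Params lam8) }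
  have hC : w.C = (datumOfRecord₁₃SepCoPH F N θ hP).C := rfl
  have hR := N24_recordG₁₃SepCoPH_of_up_withB8_rebindX_pinB10Y₀ZW₀ θ hP hθ
    (fun P : B12.RunParams => (((θ.toStage13Params.res.X P).withB12 (F12OfRecord₁₂ F N θ.toStage13Params.toStage12Params lam12 P) (lam12 P).consts).withB13OfRecord θ.toStage13Params.toStage3Params (lam13 P))) Y₀ ζ
    (fun P : B12.RunParams => (exists_printedCarriers15_b15Leaf (F.P P.K)).choose) (fun _ => Slot8 θ.toStage13Params.toStage3Params lam8) w hC ⟨hγw0, hγwγ⟩ rfl (fun P => rfl)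
  have hnodes := N24_nodes11_rOperation₁₃CoPH_rebindX_withB8_pinB10Y₀ZW₀_pointed θ hP.toCore hθ
    (fun P : B12.RunParams => (((θ.toStage13Params.res.X P).withB12 (F12OfRecord₁₂ F N θ.toStage13Params.toStage12Params lam12 P) (lam12 P).consts).withB13OfRecord θ.toStage13Params.toStage3Params (lam13 P))) Y₀ ζ
    (fun P : B12.RunParams => (exists_printedCarriers15_b15Leaf (F.P P.K)).choose) (fun _ => Slot8 θ.toStage13Params.toStage3Params lam8) w hC ⟨hγw0, hγwγ⟩ rfl (fun P => rfl)
    (fun P => h05) h06 h07 h08 (fun P => h09 P) (h09T w hC hγw9) (fun P _ _ _ _ => h10 P) (h11 w hC rfl rfl hγw11) hlaws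
  have hceil := runCeiling_of_betaUpperH hbox' (min_le_left θ.γ γ')
  have hflow : ∀ P : B12.RunParams, Dag.FlowStepPrinted (leavesP w P) :=
    flowStepPrinted_leavesP_of_betaUpperH_noShrinkG hR (le_min hγwγ hγw13) (min_le_left θ.γ γ') hbox'
      (fun n gs hrg hI m n' hmn hn' => hns n gs hrg (fun k hk => ⟨(hI k hk).1, (hI k hk).2.trans (min_le_right θ.γ γ')⟩) m n' hmn hn')
  have h1 : B16.Thm1Printed w.C := thm1Printed_of_nodes11_of_rOperation w hγw0 (fun P => (hnodes P).1) (fun P => (hnodes P).2) hflow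
  refine ⟨hU, hθ, ?_, window_of_frequently_beta_le _ (exists_frequently_betaZero_le_of_runCeiling (lt_min hγ₀ hγ') hceil)⟩
  rw [← hC]
  exact h1

/-! ## §2. `N = 2`, per `F`: K1⁹'s consequent at an abstract witness with a free [B9] bundle (N13 in the a.e. currency at `θ`) -/

/-- **★★★ K1⁹'s θ-KEYED CONSEQUENT AT `F` AT AN ABSTRACT ADMISSIBLE WITNESS WITH A FREE [B9] BUNDLE `Y₀`** — p650613 §2 with `h06 : B9LeafX Y₀`: the four door rows, `0 < θ.γ` + upper
box, children at `θ` (N05 at `Slot8`, N06 at `Y₀`, N07–N11), N13 a.e. rows, NODE O run rows ⊢ K1⁹'s body at `F` (datum re-chosen by dag-n13-w2's junction).  CONDITIONAL; N13 NOT discharged.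
[cite: Balaban1989LargeFieldII, Thm 1 p.355, (0.1) pp.355–356, p.391; Balaban1988Convergent, Cor. 3 (2.50) p.264, (0.2) p.244, (2.6) p.255; Balaban1987RG1, Thm 3 p.264, (1.20)–(1.22) p.264, §1 pp.263–264, (0.17)–(0.20) pp.255–256; Balaban1985RegularSpaces, Prop. 7 (1.145) p.100, Thm 8 (1.146) p.101 (bookkeeping)] -/
theorem N24_stabilityBRunRowsR13SepCoPHV_consequent_childrenSplitSlot8Thm1AE_atWitness_pinY₀_of_runRowsCont (Slot8 : (θ₃ : Stage3Params) → ResidB8 θ₃ → Prop) (θ : Stage13HParams F 2)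
    (hP : θ.Provisos₁₃SepCoPH F 2) (hθ : θ.Admissible F 2) (hU : θ.ZhUnity F 2 ∧ θ.SlotsNondegenerate₁₃ F 2)
    (hlaws : ∀ (P : B12.RunParams) (k : ℕ), k < P.K → TLaw₁₃CoPH F 2 θ P k → SLaw₁₃CoPH F 2 θ P (k + 1))
    {β' : ℝ} (hγ₀ : 0 < θ.γ) (hbox' : BetaUpperH β' θ.γ (betaOfRecord₁₃ F 2 θ.toStage13Params))
    (h05 : ∃ lam8 : ResidB8 θ.toStage13Params.toStage3Params, Slot8 θ.toStage13Params.toStage3Params lam8)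
    (Y₀ : PrintedCarriers9X) (h06 : B9LeafX Y₀)
    (h07 : ∃ ζ : ResidZ F 2, B11Leaf (Z11OfRecord F 2 ζ))
    (h08 : PrintedUV3V 2 θ.L)
    (h09 : ∃ lam12 : ResidB12 F 2 θ.toStage13Params.τ9.M,
      ∀ P : B12.RunParams, B12Sec2to5.Lemma4Printed (F12OfRecord₁₂ F 2 θ.toStage13Params.toStage12Params lam12 P) (lam12 P).consts)
    (h09T : ∃ γ₉ : ℝ, 0 < γ₉ ∧ ∀ w : WorldP, w.C = (datumOfRecord₁₃SepCoPH F 2 θ hP).C →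
      w.γ ≤ γ₉ → ∀ P : B12.RunParams, (leavesP w P).smallCouplings → (leavesP w P).smallFieldInductive)
    (h10 : ∃ lam13 : B12.RunParams → ResidB13 θ.toStage13Params.toStage3Params,
      ∀ P : B12.RunParams, B13LeafOfRecord θ.toStage13Params.toStage3Params (lam13 P))
    (h11 : ∀ βup β₀ : ℝ, ∃ γ₁₁ : ℝ, 0 < γ₁₁ ∧ ∀ w : WorldP, w.C = (datumOfRecord₁₃SepCoPH F 2 θ hP).C →
      w.βup = βup → w.β₀ = β₀ → w.γ ≤ γ₁₁ → ∀ P : B12.RunParams, (leavesP w P).b7 → (leavesP w P).b8 → (leavesP w P).b9 → (leavesP w P).b10 → (leavesP w P).b11 →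
      (leavesP w P).smallCouplings → (leavesP w P).smallFieldInductive → (leavesP w P).flowControl →
        ∀ k, k < P.K → SLaw₁₃CoPH F 2 θ P k → TLaw₁₃CoPH F 2 θ P k)
    (h13 : ∃ γ₁₃ : ℝ, 0 < γ₁₃ ∧ ∃ em ep : ℝ → ℝ,
        (∀ P : B12.RunParams, ((datumOfRecord₁₃SepCoPH F 2 θ hP).C P).flow.InInterval γ₁₃ P.K → SLaw₁₃CoPH F 2 θ P 0 →
      ∀ U : GaugeField (F.P P.K) 0 (SU 2),
        chiβOfRecord₁₃ F 2 θ.toStage13Params P.K (gOfRecord₁₃ F 2 θ.toStage13Params P) 0 U *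
              Real.exp (-(1 / (gOfRecord₁₃ F 2 θ.toStage13Params P 0) ^ 2 * wilsonBGOfRecord F 2 θ.εbg P 0 U)
                - em (gOfRecord₁₃ F 2 θ.toStage13Params P 0) * (Fintype.card (Site (F.P P.K) 0) : ℝ)) ≤ densOfRecord₁₃ F 2 θ.toStage13Params P 0 U ∧
          densOfRecord₁₃ F 2 θ.toStage13Params P 0 U ≤ Real.exp (ep (gOfRecord₁₃ F 2 θ.toStage13Params P 0) * (Fintype.card (Site (F.P P.K) 0) : ℝ))) ∧
        (∀ P : B12.RunParams, ((datumOfRecord₁₃SepCoPH F 2 θ hP).C P).flow.InInterval γ₁₃ P.K → ∀ k, k + 1 ≤ P.K → SLaw₁₃CoPH F 2 θ P (k + 1) →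
      ∀ᵐ U ∂(fieldMeasure (F.P P.K) (k + 1) (SU 2)),
        chiβOfRecord₁₃ F 2 θ.toStage13Params P.K (gOfRecord₁₃ F 2 θ.toStage13Params P) (k + 1) U *
              Real.exp (-(1 / (gOfRecord₁₃ F 2 θ.toStage13Params P (k + 1)) ^ 2 * wilsonBGOfRecord F 2 θ.εbg P (k + 1) U)
                - em (gOfRecord₁₃ F 2 θ.toStage13Params P (k + 1)) * (Fintype.card (Site (F.P P.K) (k + 1)) : ℝ)) ≤ densOfRecord₁₃ F 2 θ.toStage13Params P (k + 1) U ∧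
          densOfRecord₁₃ F 2 θ.toStage13Params P (k + 1) U ≤ Real.exp (ep (gOfRecord₁₃ F 2 θ.toStage13Params P (k + 1)) * (Fintype.card (Site (F.P P.K) (k + 1)) : ℝ))))
    (hrowsR : ∃ (b : ℕ → ℝ) (r γ₀ M : ℝ), 0 < γ₀ ∧
        (∀ (n : ℕ) (gs : ℕ → ℝ), RGEqH n (betaOfRecord₁₃ F 2 θ.toStage13Params) gs → Step.InInterval γ₀ n gs → ∀ k, k ≤ n → |betaOfRecord₁₃ F 2 θ.toStage13Params k (prefixOf gs k) - b k| ≤ r) ∧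
        (∀ (n : ℕ) (gs : ℕ → ℝ), RGEqH n (betaOfRecord₁₃ F 2 θ.toStage13Params) gs → Step.InInterval γ₀ n gs → ∀ k, k ≤ n → -M ≤ ∑ j ∈ Finset.Ico k n, betaOfRecord₁₃ F 2 θ.toStage13Params j (prefixOf gs j)) ∧
        ∀ k : ℕ, ContinuousOn (fun x : ℝ => betaOfRecord₁₃ F 2 θ.toStage13Params k (clampPrefix (betaOfRecord₁₃ F 2 θ.toStage13Params) γ₀ k x))
          {x : ℝ | 0 < x ∧ x ≤ γ₀ ∧ ∀ j', j' ≤ k → 1 / γ₀ ^ 2 ≤ Y (betaOfRecord₁₃ F 2 θ.toStage13Params) γ₀ j' x}) :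
    ∃ (θ' : Stage13HParams F 2) (h' : θ'.Provisos₁₃SepCoPH F 2) (v' : Revision₁₃ F 2 θ' h'), (θ'.ZhUnity F 2 ∧ θ'.SlotsNondegenerate₁₃ F 2) ∧ θ'.Admissible F 2 ∧
      B16.EndStatementBPrinted (datumOfRecord₁₃SepCoPHV F 2 θ' h' v').C ∧
      (∃ γ₁ : ℝ, 0 < γ₁ ∧ ∀ γ : ℝ, 0 < γ → γ ≤ γ₁ → ∃ P : B12.RunParams, 1 ≤ P.K ∧ ((datumOfRecord₁₃SepCoPHV F 2 θ' h' v').C P).flow.InInterval γ P.K) ∧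
      ∃ (b : ℕ → ℝ) (r γ₀ M : ℝ), 0 < γ₀ ∧
        (∀ (n : ℕ) (gs : ℕ → ℝ), RGEqH n (betaOfRecord₁₃ F 2 θ'.toStage13Params) gs → Step.InInterval γ₀ n gs → ∀ k, k ≤ n → |betaOfRecord₁₃ F 2 θ'.toStage13Params k (prefixOf gs k) - b k| ≤ r) ∧
        (∀ (n : ℕ) (gs : ℕ → ℝ), RGEqH n (betaOfRecord₁₃ F 2 θ'.toStage13Params) gs → Step.InInterval γ₀ n gs → ∀ k, k ≤ n → -M ≤ ∑ j ∈ Finset.Ico k n, betaOfRecord₁₃ F 2 θ'.toStage13Params j (prefixOf gs j)) ∧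
        ∀ k : ℕ, ContinuousOn (fun x : ℝ => betaOfRecord₁₃ F 2 θ'.toStage13Params k (clampPrefix (betaOfRecord₁₃ F 2 θ'.toStage13Params) γ₀ k x))
          {x : ℝ | 0 < x ∧ x ≤ γ₀ ∧ ∀ j', j' ≤ k → 1 / γ₀ ^ 2 ≤ Y (betaOfRecord₁₃ F 2 θ'.toStage13Params) γ₀ j' x} := by
  obtain ⟨b, r, γR, M, hγR, hrem, hps, hcont⟩ := hrowsR
  obtain ⟨hU', hθ', hT1, hwin⟩ := N24_thm1R13SepCoPH_worldBuiltG_childrenSplitSlot8_psFloor_atWitness_pinY₀_pointed Slot8 θ hP hθ hU hlaws hγ₀ hbox'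
    h05 Y₀ h06 h07 h08 h09 h09T h10 h11 hγR hps
  obtain ⟨γ₁₃, hγ₁₃, em, ep, h0, hae⟩ := h13
  obtain ⟨v, hB⟩ := exists_revision₁₃_endStatementBPrinted_of_thm1_of_row0_of_aeRowSucc F 2 _ _ hT1 hγ₁₃ h0 hae
  exact ⟨_, _, v, hU', hθ', hB, hwin, b, r, γR, M, hγR, hrem, hps, hcont⟩

/-! ## §3. ★★★★ K1⁹ BY ITS ROUTE NAME FROM AN ABSTRACT WITNESS FAMILY WITH A [B9] BUNDLE FAMILY `Y₀ F i` -/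

/-- **★★★★ K1⁹ `StabilityBRunRowsAtRecordR13SepCoPHV` (stmt-QuantumFields-27364) BY ITS ROUTE NAME, DOOR-FREE, WITNESS-FREE AND [B9]-BUNDLE-FREE** — p650613 §3 with a bundle family
`Y₀ : ∀ F, ι F → PrintedCarriers9X` and `h06 : ∀ F i, B9LeafX (Y₀ F i)`; every concrete face (`Y9OfRecord … ops`, `Y9OfRecordP … ops`, any witness door) is ONE `exact` of this theorem.
CONDITIONAL (every family displayed; audit `proof.conditional`); not a closure; no v10 stub used or closed; no count moved.
[cite: Balaban1989LargeFieldII, Thm 1 p.355, (0.1) pp.355–356, p.391; Balaban1988Convergent, Cor. 3 (2.50) p.264, (0.2) p.244; Balaban1987RG1, Thm 3 p.264, (1.20)–(1.22) p.264, §1 pp.263–264; Balaban1985RegularSpaces, Prop. 7 (1.145) p.100, Thm 8 (1.146) p.101; Balaban1985BackgroundPropagators, Thm 3.1 p.397 (bookkeeping)] -/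
theorem N24_stabilityBRunRowsAtRecordR13SepCoPHV_byName_of_abstractWitnessFamily_childrenSplitSlot8Thm1AE_pinY₀_of_runRowsCont (Slot8 : (θ₃ : Stage3Params) → ResidB8 θ₃ → Prop)
    (ι : T4Family → Type) (Θ : ∀ F : T4Family, ι F → Stage13HParams F 2) (hK0 : ∀ F : T4Family, Inhabited13 F → Nonempty (ι F))
    (hP : ∀ (F : T4Family) (i : ι F), (Θ F i).Provisos₁₃SepCoPH F 2) (hθ : ∀ (F : T4Family) (i : ι F), (Θ F i).Admissible F 2)
    (hU : ∀ (F : T4Family) (i : ι F), (Θ F i).ZhUnity F 2 ∧ (Θ F i).SlotsNondegenerate₁₃ F 2)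
    (hlaws : ∀ (F : T4Family) (i : ι F) (P : B12.RunParams) (k : ℕ), k < P.K → TLaw₁₃CoPH F 2 (Θ F i) P k → SLaw₁₃CoPH F 2 (Θ F i) P (k + 1))
    (βup : ∀ F : T4Family, ι F → ℝ) (hγ₀ : ∀ (F : T4Family) (i : ι F), 0 < (Θ F i).γ)
    (hbox' : ∀ (F : T4Family) (i : ι F), BetaUpperH (βup F i) (Θ F i).γ (betaOfRecord₁₃ F 2 (Θ F i).toStage13Params))
    (h05 : ∀ (F : T4Family) (i : ι F), ∃ lam8 : ResidB8 (Θ F i).toStage13Params.toStage3Params, Slot8 (Θ F i).toStage13Params.toStage3Params lam8)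
    (Y₀ : ∀ F : T4Family, ι F → PrintedCarriers9X) (h06 : ∀ (F : T4Family) (i : ι F), B9LeafX (Y₀ F i))
    (h07 : ∀ F : T4Family, ∃ ζ : ResidZ F 2, B11Leaf (Z11OfRecord F 2 ζ))
    (h08 : ∀ (F : T4Family) (i : ι F), PrintedUV3V 2 (Θ F i).L)
    (h09 : ∀ (F : T4Family) (i : ι F), ∃ lam12 : ResidB12 F 2 (Θ F i).toStage13Params.τ9.M,
      ∀ P : B12.RunParams, B12Sec2to5.Lemma4Printed (F12OfRecord₁₂ F 2 (Θ F i).toStage13Params.toStage12Params lam12 P) (lam12 P).consts)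
    (h09T : ∀ (F : T4Family) (i : ι F), ∃ γ₉ : ℝ, 0 < γ₉ ∧ ∀ w : WorldP, w.C = (datumOfRecord₁₃SepCoPH F 2 (Θ F i) (hP F i)).C →
      w.γ ≤ γ₉ → ∀ P : B12.RunParams, (leavesP w P).smallCouplings → (leavesP w P).smallFieldInductive)
    (h10 : ∀ (F : T4Family) (i : ι F), ∃ lam13 : B12.RunParams → ResidB13 (Θ F i).toStage13Params.toStage3Params,
      ∀ P : B12.RunParams, B13LeafOfRecord (Θ F i).toStage13Params.toStage3Params (lam13 P))
    (h11 : ∀ (F : T4Family) (i : ι F), ∀ βup β₀ : ℝ, ∃ γ₁₁ : ℝ, 0 < γ₁₁ ∧ ∀ w : WorldP, w.C = (datumOfRecord₁₃SepCoPH F 2 (Θ F i) (hP F i)).C →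
      w.βup = βup → w.β₀ = β₀ → w.γ ≤ γ₁₁ → ∀ P : B12.RunParams, (leavesP w P).b7 → (leavesP w P).b8 → (leavesP w P).b9 → (leavesP w P).b10 → (leavesP w P).b11 →
      (leavesP w P).smallCouplings → (leavesP w P).smallFieldInductive → (leavesP w P).flowControl →
        ∀ k, k < P.K → SLaw₁₃CoPH F 2 (Θ F i) P k → TLaw₁₃CoPH F 2 (Θ F i) P k)
    (h13 : ∀ (F : T4Family) (i : ι F), ∃ γ₁₃ : ℝ, 0 < γ₁₃ ∧ ∃ em ep : ℝ → ℝ,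
        (∀ P : B12.RunParams, ((datumOfRecord₁₃SepCoPH F 2 (Θ F i) (hP F i)).C P).flow.InInterval γ₁₃ P.K → SLaw₁₃CoPH F 2 (Θ F i) P 0 →
      ∀ U : GaugeField (F.P P.K) 0 (SU 2),
        chiβOfRecord₁₃ F 2 (Θ F i).toStage13Params P.K (gOfRecord₁₃ F 2 (Θ F i).toStage13Params P) 0 U *
              Real.exp (-(1 / (gOfRecord₁₃ F 2 (Θ F i).toStage13Params P 0) ^ 2 * wilsonBGOfRecord F 2 (Θ F i).εbg P 0 U)
                - em (gOfRecord₁₃ F 2 (Θ F i).toStage13Params P 0) * (Fintype.card (Site (F.P P.K) 0) : ℝ)) ≤ densOfRecord₁₃ F 2 (Θ F i).toStage13Params P 0 U ∧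
          densOfRecord₁₃ F 2 (Θ F i).toStage13Params P 0 U ≤ Real.exp (ep (gOfRecord₁₃ F 2 (Θ F i).toStage13Params P 0) * (Fintype.card (Site (F.P P.K) 0) : ℝ))) ∧
        (∀ P : B12.RunParams, ((datumOfRecord₁₃SepCoPH F 2 (Θ F i) (hP F i)).C P).flow.InInterval γ₁₃ P.K → ∀ k, k + 1 ≤ P.K → SLaw₁₃CoPH F 2 (Θ F i) P (k + 1) →
      ∀ᵐ U ∂(fieldMeasure (F.P P.K) (k + 1) (SU 2)),
        chiβOfRecord₁₃ F 2 (Θ F i).toStage13Params P.K (gOfRecord₁₃ F 2 (Θ F i).toStage13Params P) (k + 1) U *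
              Real.exp (-(1 / (gOfRecord₁₃ F 2 (Θ F i).toStage13Params P (k + 1)) ^ 2 * wilsonBGOfRecord F 2 (Θ F i).εbg P (k + 1) U)
                - em (gOfRecord₁₃ F 2 (Θ F i).toStage13Params P (k + 1)) * (Fintype.card (Site (F.P P.K) (k + 1)) : ℝ)) ≤ densOfRecord₁₃ F 2 (Θ F i).toStage13Params P (k + 1) U ∧
          densOfRecord₁₃ F 2 (Θ F i).toStage13Params P (k + 1) U ≤ Real.exp (ep (gOfRecord₁₃ F 2 (Θ F i).toStage13Params P (k + 1)) * (Fintype.card (Site (F.P P.K) (k + 1)) : ℝ))))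
    (hrowsR : ∀ (F : T4Family) (i : ι F), ∃ (b : ℕ → ℝ) (r γ₀ M : ℝ), 0 < γ₀ ∧
        (∀ (n : ℕ) (gs : ℕ → ℝ), RGEqH n (betaOfRecord₁₃ F 2 (Θ F i).toStage13Params) gs → Step.InInterval γ₀ n gs → ∀ k, k ≤ n → |betaOfRecord₁₃ F 2 (Θ F i).toStage13Params k (prefixOf gs k) - b k| ≤ r) ∧
        (∀ (n : ℕ) (gs : ℕ → ℝ), RGEqH n (betaOfRecord₁₃ F 2 (Θ F i).toStage13Params) gs → Step.InInterval γ₀ n gs → ∀ k, k ≤ n → -M ≤ ∑ j ∈ Finset.Ico k n, betaOfRecord₁₃ F 2 (Θ F i).toStage13Params j (prefixOf gs j)) ∧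
        ∀ k : ℕ, ContinuousOn (fun x : ℝ => betaOfRecord₁₃ F 2 (Θ F i).toStage13Params k (clampPrefix (betaOfRecord₁₃ F 2 (Θ F i).toStage13Params) γ₀ k x))
          {x : ℝ | 0 < x ∧ x ≤ γ₀ ∧ ∀ j', j' ≤ k → 1 / γ₀ ^ 2 ≤ Y (betaOfRecord₁₃ F 2 (Θ F i).toStage13Params) γ₀ j' x}) :
    Summit.QuantumFields.YangMills.Theses.BalabanUVNodes.StabilityBRunRowsAtRecordR13SepCoPHV := by
  intro F hinh
  obtain ⟨i⟩ := hK0 F hinh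
  exact N24_stabilityBRunRowsR13SepCoPHV_consequent_childrenSplitSlot8Thm1AE_atWitness_pinY₀_of_runRowsCont Slot8 (Θ F i) (hP F i) (hθ F i) (hU F i) (hlaws F i) (hγ₀ F i) (hbox' F i)
    (h05 F i) (Y₀ F i) (h06 F i) (h07 F) (h08 F i) (h09 F i) (h09T F i) (h10 F i) (h11 F i) (h13 F i) (hrowsR F i)

end Summit.QuantumFields.YangMills.BalabanUVNodes.N24K1R9ByNameOfOpenStubsChildrenSplitSlot8Thm1AEAtAbstractWitnessY0

end
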